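import Mathlib.MeasureTheory.Integral.IntervalIntegral.Basic
import Mathlib.MeasureTheory.Function.LpSeminorm.Basic
import Mathlib.Analysis.InnerProductSpace.PiL2
import Mathlib.Order.Filter.AtTopBot.Basic
import Literature.Analysis.FluidPDE.ClassicalSolution
import Literature.Analysis.FluidPDE.VectorCalculus
import HarnessLib

/-!
# "Anomalous dissipation" for the unforced Navier–Stokes equations on `ℝ^d` from viscosity-dependent
  data (Li–Yu–Zhu, C. R. Math. 363 (2025), Thm. 1)

Topic `Analysis/FluidPDE`; a companion of `AnomalousDissipation.lean` (**turb.S10–S13**, forced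
Navier–Stokes on `T³`) recording the whole-space, zero-force, `ν`-DEPENDENT-DATA statement of

J. Li, Y. Yu, W. Zhu, *Anomalous dissipation for the d-dimensional Navier–Stokes equations*,
C. R. Math. Acad. Sci. Paris 363 (2025) 345–351, doi:10.5802/crmath.709 (open access, CC-BY; journal
PDF rendered and page-confirmed 2026-08-26) = arXiv:2307.06812 (held as `paper:arxiv-2307.06812`;
there the result is "Theorem 1.1" with displays (1.2)–(1.3), p. 3 of the arXiv PDF). Journal labels:
**Theorem 1** with displays (2)–(3), p. 347; Remark 2 (p. 347); Remark 1.2 of the arXiv version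
("viscosity alone is enough to obtain the anomalous dissipation for (NS) in the whole space").

The mechanism is purely diffusive (energy placed at the dissipative scale `|ξ|² ∼ ε_n⁻¹`, the heat
flow alone dissipating a fixed fraction of it on `[0,1]`; source, (4)–(5) and Remark 1.2 of the arXiv
version): the data depend on the viscosity, there is no force, and nothing here bears on the
`ν`-independent smooth steady force of the summit statement `Literature.Turb.ZerothLaw` or on
Bruè–De Lellis' Question 2.1 (`BrueDeLellisQuestion21`) — compare the tree's degenerate discharge
`bccds_onsager_critical_holds` (pulsed Stokes shear; `AnomalousDissipationProofs.lean`). The source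
itself (Remark 2, p. 347) records as OPEN "the construction of a family of flows" in which "more than
half of the initial energy gets transferred in time `T = 1`, by non-linear effects, towards modes of
frequency higher than `1/√(εT)`" — not Literature (an open problem), quoted here for the record only.

## Contents

* `LiYuZhu2025.visc n = 4⁻ⁿ = 2^{-2n}` — the printed viscosities `ε_n` (plumbing `def`).
* `LiYuZhu2025_thm1` — **named fact**, Theorem 1 as printed.

## Design choices (faithfulness notes)

* `ℝ^d` is `EuclideanSpace ℝ (Fin d)`, `d ≥ 2` quantified inside ("Let `d ≥ 2`"). "Smooth solutions
  `u^{ε_n} ∈ C^∞([0,1] × ℝ^d)` to the zero forced (NS)" are classical solutions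
  `IsClassicalNSSolutionOn (Icc 0 1) ε_n 0 (u n) (p n)` of `ClassicalSolution.lean` (velocity AND a
  pressure jointly `C^∞` on `[0,1] × ℝ^d`; momentum equation and `div u = 0` pointwise) with
  `u n 0 = u₀ n`; "`C^∞`-smooth initial data" is then automatic (slice at `t = 0`) and not restated.
  No decay at infinity is recorded for the witnesses beyond what (2)–(3) and the `L²` bound say
  (weaker than the Schwartz-class data of the proof; harmless for an existential statement).
* "satisfying a uniform `L²` bound": `∃ M < ∞, ∀ n, ‖u₀^{ε_n}‖_{L²(ℝ^d)} ≤ M` (Mathlib `eLpNorm`).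
* `‖∇u(t)‖²_{L²(ℝ^d)} = ∫ |∇u(t,x)|² dx` is the tree's `VectorCalculus.gradNormSq (u n t)` (Frobenius
  norm of the Fréchet derivative as density; Bochner, junk `0` on non-integrable slices — which can
  only make the lower bounds (2)–(3) harder, never vacuous), and `∫₀¹ … dt` the interval integral.
* (2) "`ε_n ∫₀¹ ‖∇u^{ε_n}‖²_{L²} dt ≳ ‖u₀^{ε_n}‖_{L²(ℝ^d)}`" (`≳`: "there is a uniform positive constant
  `C` … such that `A ≥ C B`", Notation p. 347): `∃ c > 0, ∀ n, c ‖u₀^{ε_n}‖_{L²} ≤ ε_n ∫₀¹‖∇u^{ε_n}‖²`, the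
  right-hand side printed with the NORM (not its square) of the datum in both versions, and typed so.
* (3) "`liminf_n ε_n ∫₀¹‖∇u^{ε_n}‖²_{L²} dt ≥ η` for some absolute constant `η > 0`": the junk-free
  `ε`-eventually form `∃ η > 0, ∀ᶠ n, η ≤ ε_n ∫₀¹ ‖∇u^{ε_n}‖²` (equivalent up to the value of `η`).

## References

* J. Li, Y. Yu, W. Zhu, C. R. Math. Acad. Sci. Paris 363 (2025) 345–351, Thm. 1 with (2)–(3) and
  Remark 2, p. 347 (= arXiv:2307.06812, Thm. 1.1 with (1.2)–(1.3), p. 3). [`LiYuZhu2025`]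
* E. Bruè, C. De Lellis, Comm. Math. Phys. 400 (2023) 1507–1533 ([2] of the source). [`BrueDeLellisCMP2023`]
-/

open MeasureTheory Set Filter Topology
open scoped NNReal ENNReal

noncomputable section

namespace Literature.Analysis.FluidPDE

section LiYuZhu

/-- The viscosities `ε_n = 2^{-2n} = 4⁻ⁿ` of Li–Yu–Zhu 2025, Thm. 1. [cite: LiYuZhu2025, Thm. 1 p. 347] -/
def LiYuZhu2025.visc (n : ℕ) : ℝ := ((4 : ℝ)⁻¹) ^ n

/-- `ε_n = 2^{-2n}` as printed. [cite: LiYuZhu2025, Thm. 1 p. 347] -/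
theorem LiYuZhu2025.visc_eq_two_zpow (n : ℕ) : LiYuZhu2025.visc n = (2 : ℝ) ^ (-(2 * (n : ℤ))) := by
  rw [LiYuZhu2025.visc, zpow_neg, zpow_mul, inv_pow]
  norm_num

/-- The viscosities are positive. [cite: LiYuZhu2025, Thm. 1 p. 347] -/
theorem LiYuZhu2025.visc_pos (n : ℕ) : 0 < LiYuZhu2025.visc n := by
  unfold LiYuZhu2025.visc; positivity

/-- **Li–Yu–Zhu 2025, Theorem 1** (C. R. Math. 363 (2025), p. 347; arXiv:2307.06812 Thm. 1.1 p. 3),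
verbatim: "Let `d ≥ 2`. There exists a sequence of `C^∞`-smooth initial data `u₀^{ε_n}` on `ℝ^d` with
`ε_n = 2^{−2n}` satisfying a uniform `L²` bound such that there are families of smooth solutions
`u^{ε_n}(t,x) ∈ C^∞([0,1] × ℝ^d)` to the zero forced (NS) with the property that
`ε_n ∫₀¹ ‖∇u^{ε_n}(t,x)‖²_{L²(ℝ^d)} dt ≳ ‖u₀^{ε_n}‖_{L²(ℝ^d)}`. (2) In particular, we have
`liminf_{n→∞} ε_n ∫₀¹ ‖∇u^{ε_n}(t,x)‖²_{L²(ℝ^d)} dt ≥ η`, (3) for some absolute constant `η > 0`."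
Rendering (module docstring): `ℝ^d = EuclideanSpace ℝ (Fin d)`; classical unforced Navier–Stokes
solutions `IsClassicalNSSolutionOn (Icc 0 1) ε_n 0 (u n) (p n)` with `u n 0 = u₀ n`; uniform `L²` bound
via `eLpNorm`; `‖∇u(t)‖²_{L²} = VectorCalculus.gradNormSq (u n t)`; (2) with an existential constant
`c > 0` and the datum NORM on the right, as printed; (3) in the `ε`-eventually form. Viscosity-DEPENDENT
data, zero force, whole space: no bearing on `Literature.Turb.ZerothLaw` / `BrueDeLellisQuestion21`.
[cite: LiYuZhu2025, Thm. 1 p. 347 ((2)–(3)); arXiv:2307.06812 Thm. 1.1 p. 3] -/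
def LiYuZhu2025_thm1 : Prop :=
  ∀ d : ℕ, 2 ≤ d →
    ∃ (u₀ : ℕ → EuclideanSpace ℝ (Fin d) → EuclideanSpace ℝ (Fin d))
      (u : ℕ → ℝ → EuclideanSpace ℝ (Fin d) → EuclideanSpace ℝ (Fin d))
      (p : ℕ → ℝ → EuclideanSpace ℝ (Fin d) → ℝ),
      -- a uniform `L²` bound on the (smooth) data
      (∃ M : ℝ≥0∞, M < ∞ ∧ ∀ n, eLpNorm (u₀ n) 2 volume ≤ M) ∧
      -- smooth solutions on `[0,1] × ℝ^d` of the unforced system with viscosity `ε_n`, from `u₀^{ε_n}`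
      (∀ n, IsClassicalNSSolutionOn (Icc (0 : ℝ) 1) (LiYuZhu2025.visc n) 0 (u n) (p n) ∧ u n 0 = u₀ n) ∧
      -- (2): `ε_n ∫₀¹ ‖∇u^{ε_n}‖²_{L²} dt ≳ ‖u₀^{ε_n}‖_{L²}`
      (∃ c : ℝ, 0 < c ∧ ∀ n,
        c * (eLpNorm (u₀ n) 2 volume).toReal ≤
          LiYuZhu2025.visc n * ∫ t in (0 : ℝ)..1, VectorCalculus.gradNormSq (u n t)) ∧
      -- (3): `liminf_n ε_n ∫₀¹ ‖∇u^{ε_n}‖²_{L²} dt ≥ η > 0`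
      ∃ η : ℝ, 0 < η ∧ ∀ᶠ n in atTop,
        η ≤ LiYuZhu2025.visc n * ∫ t in (0 : ℝ)..1, VectorCalculus.gradNormSq (u n t)

end LiYuZhu

end Literature.Analysis.FluidPDE

end
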